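import Literature.MathematicalPhysics.KineticTheory.HardSphereCampbellHitPieceCylinderTools
import HarnessLib

/-!
# A hit piece in pre-collision cylinder coordinates (the special pair)

Topic `Literature/MathematicalPhysics/KineticTheory`. The change of variables to collision
coordinates for one hit piece of the Gallagher–Saint-Raymond–Texier window analysis — the engine of
the discharge of the Campbell / special-flow identity `HardSphereCampbellFormula`
(Cercignani–Illner–Pulvirenti 1994 App. 4.A: on the contact hypersurface `Σᵢⱼ` of the hard-sphere
phase space "the Lebesgue measure becomes `dσ dt`", `dx = ε^{d-1} |v·n| dσ dt`).

For `s + 2` hard spheres of diameter `ε` on `T^d` and the special pair (last sphere, sphere `i`),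
a datum `u` of the hit piece `Alexander.hitPiece (s+2) ε r δ last i` (all other pairs far, the pair
at distance `≤ ε + r`, non-grazing pre-collisional relative datum hitting at a time `τ₀(u) ≤ δ`)
on the energy shell `E(u) ≤ V²/2` free-flies to the incoming contact configuration
`w_in = S_{τ₀(u)} u`, whose post-collisional configuration is `w⁺(u) = collidePair last i w_in`.
`lintegral_hitPiece_eq_cylinder_last` computes `∫ 1_{hit piece ∩ shell}(u) H(w⁺(u)) du` in the
coordinates `(z, ω, τ)`: `z^{ab}_ω = contactInsert ε last i ω z` the outgoing contact
configuration, `w_in = collidePair last i z^{ab}_ω`, `u = S_{-τ} w_in`, `τ ∈ (0, δ]`, with the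
Jacobian `ε^{d-1} (⟪ω, v_last - v_i⟫)₊` and the discarded coordinate `x_last` of `z` integrated
with mass `vol(T^d) = 1`. The proof APPLIES the tree's chart identity
`lintegral_eq_boundaryFlux_backward` (one-step mild BBGKY hierarchy) with chart radius `ε + r`:
hit-piece data are supported in the chart (`campbell_chart_of_mem_hitPiece`), the datum
`S_{-τ}(gainConfig Z' i ν v)` has hitting time `τ` in the chart
(`campbell_pairHitTime_contact_sub_smul`), and on the shell the window `τ ≤ δ` is exactly the
chart cut-off (`2 V δ ≤ r`). The window is essential: over all `τ > 0` the backward free flight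
`S_{-τ} w_in` wraps around the torus and re-enters the hit piece near every return time of the
pair to contact (e.g. `d = 1`, two spheres: for `τ ∈ (k/‖v_a - v_b‖, k/‖v_a - v_b‖ + δ']`,
every `k ∈ ℕ`), so that the `τ`-integral over `(0, ∞)` of the same integrand is infinite.

## References

* [CIP1994] C. Cercignani, R. Illner, M. Pulvirenti, *The Mathematical Theory of Dilute Gases*,
  Applied Math. Sciences 106, Springer (1994), App. 4.A pp. 107–111 ("`dx = ε^{d-1}|v·n| dσ dt`").
* [GST2013] I. Gallagher, L. Saint-Raymond, B. Texier, *From Newton to Boltzmann: hard spheres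
  and short-range potentials*, EMS (2013), proof of Prop. 4.1.1.
-/

open MeasureTheory Set Function Filter Metric
open scoped ENNReal NNReal RealInnerProductSpace

namespace Literature.MathematicalPhysics.KineticTheory

open Literature.Analysis.FluidPDE Literature.Analysis

noncomputable section

variable {d : Type*} [Fintype d] {ε : ℝ}

/-! ### Measurability of the two integrands -/

/-- The hit-piece integrand `1_{hit piece ∩ shell}(u) H(w⁺(u))` is measurable. [folklore] -/
theorem campbell_measurable_hitPieceIntegrand {N : ℕ} (ε r δ V : ℝ) (a b : Fin N)
    {H : Config N d (UnitAddTorus d) → ℝ≥0∞} (hH : Measurable H) :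
    Measurable fun u : Config N d (UnitAddTorus d) =>
      (Alexander.hitPiece N ε r δ a b ∩ {u | configEnergy u ≤ V ^ 2 / 2}).indicator
        (fun u => H (collidePair (Torus.geometry d) a b
          (freeFlight (Torus.geometry d)
            (pairHitTime ε ((Torus.geometry d).sepVec (u a).1 (u b).1) ((u a).2 - (u b).2)) u))) u := by
  have hGm := Torus.isMeasurable_geometry (d := d)
  have hS : MeasurableSet (Alexander.hitPiece N ε r δ a b ∩
      {u : Config N d (UnitAddTorus d) | configEnergy u ≤ V ^ 2 / 2}) :=
    (Alexander.measurableSet_hitPiece ε r δ a b).inter (Alexander.measurableSet_energyShell _)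
  refine Measurable.indicator ?_ hS
  exact hH.comp ((hGm.measurable_collidePair a b).comp (hGm.measurable_freeFlight₂.comp
    ((Alexander.measurable_pairHitTime_config ε a b).prodMk measurable_id)))

/-- The cylinder-coordinate integrand is jointly measurable in `((z, ω), τ)`. [folklore] -/
theorem campbell_measurable_cylinderIntegrand {N : ℕ} (ε r δ V : ℝ) (a b : Fin N)
    {H : Config N d (UnitAddTorus d) → ℝ≥0∞} (hH : Measurable H) :
    Measurable fun p : (Config N d (UnitAddTorus d) × Metric.sphere (0 : EuclideanSpace ℝ d) 1) × ℝ =>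
      ENNReal.ofReal (ε ^ (Fintype.card d - 1) * ⟪((p.1.2 : EuclideanSpace ℝ d)), (p.1.1 a).2 - (p.1.1 b).2⟫) *
        (Alexander.hitPiece N ε r δ a b ∩ {u | configEnergy u ≤ V ^ 2 / 2}).indicator (fun _ => (1 : ℝ≥0∞))
          (freeFlight (Torus.geometry d) (-p.2)
            (collidePair (Torus.geometry d) a b (contactInsert ε a b (p.1.2 : EuclideanSpace ℝ d) p.1.1))) *
        H (contactInsert ε a b (p.1.2 : EuclideanSpace ℝ d) p.1.1) := by
  have hGm := Torus.isMeasurable_geometry (d := d)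
  have hS : MeasurableSet (Alexander.hitPiece N ε r δ a b ∩
      {u : Config N d (UnitAddTorus d) | configEnergy u ≤ V ^ 2 / 2}) :=
    (Alexander.measurableSet_hitPiece ε r δ a b).inter (Alexander.measurableSet_energyShell _)
  have hz : Measurable fun p : (Config N d (UnitAddTorus d) × Metric.sphere (0 : EuclideanSpace ℝ d) 1) × ℝ =>
      p.1.1 := measurable_fst.fst
  have hω : Measurable fun p : (Config N d (UnitAddTorus d) × Metric.sphere (0 : EuclideanSpace ℝ d) 1) × ℝ =>
      (p.1.2 : EuclideanSpace ℝ d) := measurable_subtype_coe.comp measurable_fst.snd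
  have hτ : Measurable fun p : (Config N d (UnitAddTorus d) × Metric.sphere (0 : EuclideanSpace ℝ d) 1) × ℝ =>
      p.2 := measurable_snd
  have hCI : Measurable fun p : (Config N d (UnitAddTorus d) × Metric.sphere (0 : EuclideanSpace ℝ d) 1) × ℝ =>
      contactInsert ε a b (p.1.2 : EuclideanSpace ℝ d) p.1.1 :=
    (measurable_contactInsert_prod ε a b).comp measurable_fst
  have hflux : Measurable fun p : (Config N d (UnitAddTorus d) × Metric.sphere (0 : EuclideanSpace ℝ d) 1) × ℝ =>
      ENNReal.ofReal (ε ^ (Fintype.card d - 1) * ⟪((p.1.2 : EuclideanSpace ℝ d)), (p.1.1 a).2 - (p.1.1 b).2⟫) :=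
    (measurable_const.mul (hω.inner (((measurable_pi_apply a).comp hz).snd.sub
      ((measurable_pi_apply b).comp hz).snd))).ennreal_ofReal
  have hff : Measurable fun p : (Config N d (UnitAddTorus d) × Metric.sphere (0 : EuclideanSpace ℝ d) 1) × ℝ =>
      freeFlight (Torus.geometry d) (-p.2)
        (collidePair (Torus.geometry d) a b (contactInsert ε a b (p.1.2 : EuclideanSpace ℝ d) p.1.1)) :=
    hGm.measurable_freeFlight₂.comp (hτ.neg.prodMk ((hGm.measurable_collidePair a b).comp hCI))
  exact (hflux.mul ((measurable_const.indicator hS).comp hff)).mul (hH.comp hCI)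

/-- The cylinder-coordinate integral over `(ω, τ) ∈ S^{d-1} × (0, δ]` is a measurable function of
the configuration `z` (Tonelli). [folklore] -/
theorem campbell_measurable_cylinderIntegral {N : ℕ} (ε r δ V : ℝ) (a b : Fin N)
    {H : Config N d (UnitAddTorus d) → ℝ≥0∞} (hH : Measurable H) :
    Measurable fun z : Config N d (UnitAddTorus d) =>
      ∫⁻ ω : Metric.sphere (0 : EuclideanSpace ℝ d) 1, ∫⁻ τ in Ioc (0 : ℝ) δ,
        ENNReal.ofReal (ε ^ (Fintype.card d - 1) * ⟪((ω : EuclideanSpace ℝ d)), (z a).2 - (z b).2⟫) *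
          (Alexander.hitPiece N ε r δ a b ∩ {u | configEnergy u ≤ V ^ 2 / 2}).indicator (fun _ => (1 : ℝ≥0∞))
            (freeFlight (Torus.geometry d) (-τ)
              (collidePair (Torus.geometry d) a b (contactInsert ε a b (ω : EuclideanSpace ℝ d) z))) *
          H (contactInsert ε a b (ω : EuclideanSpace ℝ d) z)
        ∂volume ∂(volume : Measure (EuclideanSpace ℝ d)).toSphere := by
  have hK := campbell_measurable_cylinderIntegrand ε r δ V a b hH
  have h1 : Measurable fun q : Config N d (UnitAddTorus d) × Metric.sphere (0 : EuclideanSpace ℝ d) 1 =>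
      ∫⁻ τ in Ioc (0 : ℝ) δ,
        ENNReal.ofReal (ε ^ (Fintype.card d - 1) * ⟪((q.2 : EuclideanSpace ℝ d)), (q.1 a).2 - (q.1 b).2⟫) *
          (Alexander.hitPiece N ε r δ a b ∩ {u | configEnergy u ≤ V ^ 2 / 2}).indicator (fun _ => (1 : ℝ≥0∞))
            (freeFlight (Torus.geometry d) (-τ)
              (collidePair (Torus.geometry d) a b (contactInsert ε a b (q.2 : EuclideanSpace ℝ d) q.1))) *
          H (contactInsert ε a b (q.2 : EuclideanSpace ℝ d) q.1) :=
    hK.lintegral_prod_right'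
  exact h1.lintegral_prod_right'

/-! ### The pointwise identity in the collision coordinates -/

/-- **The two integrands agree pointwise** in the collision coordinates `(Z', v, ν, τ)`, `τ > 0`:
the window-cut cylinder integrand of the hit piece (left) and the chart integrand of
`lintegral_eq_boundaryFlux_backward` for `g = 1_{hit piece ∩ shell} · (H ∘ w⁺)` and chart radius
`ε + r` (right). In the chart the datum `u = S_{-τ}(gainConfig Z' i ν v)` has hitting time `τ` and
`w⁺(u) = lossConfig Z' i ν v`; on the shell, `τ ≤ δ` forces the chart (`2Vδ ≤ r`), and off the
window the hit piece forces `τ = τ₀(u) ≤ δ`. [folklore] -/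
theorem campbell_cylinder_pointwise {s : ℕ} (i : Fin (s + 1)) {r δ V : ℝ} (hε : 0 < ε)
    (hch : ε + 2 * r < 2⁻¹) (hr : 2 * V * δ ≤ r) (hV : 0 ≤ V) (hδ : 0 ≤ δ)
    (H : Config (s + 1 + 1) d (UnitAddTorus d) → ℝ≥0∞) (Z' : Config (s + 1) d (UnitAddTorus d))
    (v : EuclideanSpace ℝ d) (ν : Metric.sphere (0 : EuclideanSpace ℝ d) 1) {τ : ℝ} (hτ : 0 < τ) :
    (Iic δ).indicator (fun τ : ℝ =>
        ENNReal.ofReal (ε ^ (Fintype.card d - 1) * ⟪((ν : EuclideanSpace ℝ d)), v - (Z' i).2⟫) *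
          (Alexander.hitPiece (s + 1 + 1) ε r δ (Fin.natAdd (s + 1) 0) (Fin.castAdd 1 i) ∩
              {u | configEnergy u ≤ V ^ 2 / 2}).indicator (fun _ => (1 : ℝ≥0∞))
            (freeFlight (Torus.geometry d) (-τ) (gainConfig (Torus.geometry d) ε Z' i ν v)) *
          H (lossConfig (Torus.geometry d) ε Z' i ν v)) τ =
      (collisionCylDom (v - (Z' i).2)).indicator (fun _ => (1 : ℝ≥0∞)) (ν : EuclideanSpace ℝ d) *
        (ENNReal.ofReal (ε ^ (Fintype.card d - 1) * ⟪v - (Z' i).2, ((ν : EuclideanSpace ℝ d))⟫) *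
          ((closedBall (0 : EuclideanSpace ℝ d) (ε + r)).indicator
            (fun _ => (Alexander.hitPiece (s + 1 + 1) ε r δ (Fin.natAdd (s + 1) 0) (Fin.castAdd 1 i) ∩
                {u | configEnergy u ≤ V ^ 2 / 2}).indicator
              (fun u => H (collidePair (Torus.geometry d) (Fin.natAdd (s + 1) 0) (Fin.castAdd 1 i)
                (freeFlight (Torus.geometry d)
                  (pairHitTime ε
                    ((Torus.geometry d).sepVec (u (Fin.natAdd (s + 1) 0)).1 (u (Fin.castAdd 1 i)).1)
                    ((u (Fin.natAdd (s + 1) 0)).2 - (u (Fin.castAdd 1 i)).2)) u)))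
              (freeFlight (Torus.geometry d) (-τ) (gainConfig (Torus.geometry d) ε Z' i ν v)))
            (ε • (ν : EuclideanSpace ℝ d) -
              τ • ((collide ν ((Z' i).2, v)).2 - (collide ν ((Z' i).2, v)).1)))) := by
  classical
  have hr0 : 0 ≤ r := le_trans (by positivity) hr
  have hε' : ε < 2⁻¹ := by linarith
  have hρ : ε + r < 1 / 2 := by rw [one_div]; linarith
  have hcomm : ⟪((ν : EuclideanSpace ℝ d)), v - (Z' i).2⟫ = ⟪v - (Z' i).2, ((ν : EuclideanSpace ℝ d))⟫ :=
    real_inner_comm _ _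
  by_cases hflux : 0 < ⟪v - (Z' i).2, ((ν : EuclideanSpace ℝ d))⟫
  swap
  · -- nonpositive flux: both sides vanish
    have h0 : ENNReal.ofReal (ε ^ (Fintype.card d - 1) * ⟪((ν : EuclideanSpace ℝ d)), v - (Z' i).2⟫) = 0 := by
      rw [hcomm]
      exact ENNReal.ofReal_eq_zero.2
        (mul_nonpos_of_nonneg_of_nonpos (pow_nonneg hε.le _) (not_lt.1 hflux))
    rw [indicator_of_notMem (show ((ν : EuclideanSpace ℝ d)) ∉ collisionCylDom (v - (Z' i).2) from hflux),
      zero_mul]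
    by_cases hτδ : τ ∈ Iic δ
    · rw [indicator_of_mem hτδ, h0, zero_mul, zero_mul]
    · rw [indicator_of_notMem hτδ]
  rw [indicator_of_mem (show ((ν : EuclideanSpace ℝ d)) ∈ collisionCylDom (v - (Z' i).2) from hflux), one_mul]
  by_cases huS : freeFlight (Torus.geometry d) (-τ) (gainConfig (Torus.geometry d) ε Z' i ν v) ∈
      Alexander.hitPiece (s + 1 + 1) ε r δ (Fin.natAdd (s + 1) 0) (Fin.castAdd 1 i) ∩
        {u | configEnergy u ≤ V ^ 2 / 2}
  swap
  · -- the datum is not in the hit piece: both sides vanish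
    by_cases hball : ε • (ν : EuclideanSpace ℝ d) -
        τ • ((collide ν ((Z' i).2, v)).2 - (collide ν ((Z' i).2, v)).1) ∈
          closedBall (0 : EuclideanSpace ℝ d) (ε + r)
    · rw [indicator_of_mem hball, indicator_of_notMem huS, mul_zero]
      by_cases hτδ : τ ∈ Iic δ
      · rw [indicator_of_mem hτδ, indicator_of_notMem huS, mul_zero, zero_mul]
      · rw [indicator_of_notMem hτδ]
    · rw [indicator_of_notMem hball, mul_zero]
      by_cases hτδ : τ ∈ Iic δ
      · rw [indicator_of_mem hτδ, indicator_of_notMem huS, mul_zero, zero_mul]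
      · rw [indicator_of_notMem hτδ]
  -- the datum is in the hit piece, with positive flux
  obtain ⟨hva, hvb⟩ := campbell_backData_vel i ε Z' ν v τ
  have hspeed : ‖(collide ν ((Z' i).2, v)).2 - (collide ν ((Z' i).2, v)).1‖ ≤ 2 * V := by
    have h := Alexander.norm_vel_sub_le (fun k => norm_vel_le_of_configEnergy_le hV huS.2 k)
      (Fin.natAdd (s + 1) 0) (Fin.castAdd 1 i)
    rwa [hva, hvb] at h
  have hnorm : ‖ε • (ν : EuclideanSpace ℝ d)‖ = ε := by
    rw [norm_smul, Real.norm_of_nonneg hε.le, norm_eq_of_mem_sphere ν, mul_one]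
  have hin : ⟪ε • (ν : EuclideanSpace ℝ d), (collide ν ((Z' i).2, v)).2 - (collide ν ((Z' i).2, v)).1⟫ < 0 := by
    rw [real_inner_smul_left, real_inner_comm, campbell_inner_collide_sub, mul_neg, neg_lt_zero]
    exact mul_pos hε hflux
  -- in the chart, the hitting time of the datum is `τ`
  have hchart : ε • (ν : EuclideanSpace ℝ d) -
      τ • ((collide ν ((Z' i).2, v)).2 - (collide ν ((Z' i).2, v)).1) ∈ closedBall (0 : EuclideanSpace ℝ d) (ε + r) →
      pairHitTime ε
        ((Torus.geometry d).sepVec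
          (freeFlight (Torus.geometry d) (-τ) (gainConfig (Torus.geometry d) ε Z' i ν v) (Fin.natAdd (s + 1) 0)).1
          (freeFlight (Torus.geometry d) (-τ) (gainConfig (Torus.geometry d) ε Z' i ν v) (Fin.castAdd 1 i)).1)
        ((freeFlight (Torus.geometry d) (-τ) (gainConfig (Torus.geometry d) ε Z' i ν v) (Fin.natAdd (s + 1) 0)).2 -
          (freeFlight (Torus.geometry d) (-τ) (gainConfig (Torus.geometry d) ε Z' i ν v) (Fin.castAdd 1 i)).2) = τ := by
    intro hball
    rw [campbell_backData_sepVec i ε Z' ν v τ (Torus.closedBall_subset_symCube hρ hball), hva, hvb]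
    exact campbell_pairHitTime_contact_sub_smul hε.le hnorm hin τ
  by_cases hτδ : τ ≤ δ
  · -- inside the window: the datum is in the chart
    have hball : ε • (ν : EuclideanSpace ℝ d) -
        τ • ((collide ν ((Z' i).2, v)).2 - (collide ν ((Z' i).2, v)).1) ∈ closedBall (0 : EuclideanSpace ℝ d) (ε + r) := by
      rw [mem_closedBall, dist_zero_right]
      calc ‖ε • (ν : EuclideanSpace ℝ d) - τ • ((collide ν ((Z' i).2, v)).2 - (collide ν ((Z' i).2, v)).1)‖
          ≤ ‖ε • (ν : EuclideanSpace ℝ d)‖ + ‖τ • ((collide ν ((Z' i).2, v)).2 - (collide ν ((Z' i).2, v)).1)‖ :=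
            norm_sub_le _ _
        _ = ε + τ * ‖(collide ν ((Z' i).2, v)).2 - (collide ν ((Z' i).2, v)).1‖ := by
            rw [hnorm, norm_smul, Real.norm_of_nonneg hτ.le]
        _ ≤ ε + δ * (2 * V) := by
            have h : τ * ‖(collide ν ((Z' i).2, v)).2 - (collide ν ((Z' i).2, v)).1‖ ≤ δ * (2 * V) :=
              mul_le_mul hτδ hspeed (norm_nonneg _) hδ
            linarith
        _ ≤ ε + r := by
            have h : δ * (2 * V) = 2 * V * δ := by ring
            linarith
    have hτ0 := hchart hball
    rw [indicator_of_mem (show τ ∈ Iic δ from hτδ), indicator_of_mem huS, indicator_of_mem hball,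
      indicator_of_mem huS, hτ0, ← freeFlight_add, add_neg_cancel, freeFlight_zero,
      campbell_collidePair_gainConfig hε hε' Z' i ν v, hcomm, mul_one]
  · -- outside the window: the datum is off the chart
    have hball : ε • (ν : EuclideanSpace ℝ d) -
        τ • ((collide ν ((Z' i).2, v)).2 - (collide ν ((Z' i).2, v)).1) ∉ closedBall (0 : EuclideanSpace ℝ d) (ε + r) := by
      intro hball
      apply hτδ
      rw [← hchart hball]
      exact huS.1.2.2.2
    rw [indicator_of_notMem (show τ ∉ Iic δ from hτδ), indicator_of_notMem hball, mul_zero]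

/-! ### The engine -/

/-- **A hit piece in pre-collision cylinder coordinates (special pair).** For `s + 2` hard spheres
of diameter `ε` on `T^d`, the pair (`last`, `i`), a window `δ ≥ 0`, a speed bound `V ≥ 0` and an
interaction length `r ≥ 2Vδ` with `ε + 2r < 1/2`, and a measurable `H ≥ 0`:
`∫ 1_{hitPiece ∩ {E ≤ V²/2}}(u) H(w⁺(u)) du
  = ∫ dz ∫ dσ(ω) ∫_{(0,δ]} dτ ε^{d-1}(⟪ω, v_last - v_i⟫)₊ 1_{hitPiece ∩ {E ≤ V²/2}}(S_{-τ} w_in) H(z^{ab}_ω)`,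
`z^{ab}_ω = contactInsert ε last i ω z`, `w_in = collidePair last i z^{ab}_ω`, `w⁺(u)` the
post-collisional configuration at the first contact of the pair along the free flight of `u`
(CIP's "`dx = ε^{d-1}|v·n| dσ dt`" on the pre-collisional cylinder of the pair; the discarded
coordinate `x_last` of `z` carries mass `vol(T^d) = 1`; the window `τ ∈ (0, δ]` keeps the pair in
one chart of the torus, `2Vδ ≤ r`, `ε + 2r < 1/2`). [cite: CIP1994, App. 4.A pp. 107–111] -/
theorem lintegral_hitPiece_eq_cylinder_last [Nonempty d] {s : ℕ} (i : Fin (s + 1)) {r δ V : ℝ} (hε : 0 < ε)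
    (hch : ε + 2 * r < 2⁻¹) (hr : 2 * V * δ ≤ r) (hV : 0 ≤ V) (hδ : 0 ≤ δ)
    {H : Config (s + 1 + 1) d (UnitAddTorus d) → ℝ≥0∞} (hH : Measurable H) :
    ∫⁻ u : Config (s + 1 + 1) d (UnitAddTorus d),
        (Alexander.hitPiece (s + 1 + 1) ε r δ (Fin.natAdd (s + 1) 0) (Fin.castAdd 1 i) ∩
            {u | configEnergy u ≤ V ^ 2 / 2}).indicator
          (fun u => H (collidePair (Torus.geometry d) (Fin.natAdd (s + 1) 0) (Fin.castAdd 1 i)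
            (freeFlight (Torus.geometry d)
              (pairHitTime ε ((Torus.geometry d).sepVec (u (Fin.natAdd (s + 1) 0)).1 (u (Fin.castAdd 1 i)).1)
                ((u (Fin.natAdd (s + 1) 0)).2 - (u (Fin.castAdd 1 i)).2)) u))) u =
      ∫⁻ z : Config (s + 1 + 1) d (UnitAddTorus d), ∫⁻ ω : Metric.sphere (0 : EuclideanSpace ℝ d) 1,
        ∫⁻ τ in Ioc (0 : ℝ) δ,
          ENNReal.ofReal (ε ^ (Fintype.card d - 1) *
              ⟪((ω : EuclideanSpace ℝ d)), (z (Fin.natAdd (s + 1) 0)).2 - (z (Fin.castAdd 1 i)).2⟫) *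
            (Alexander.hitPiece (s + 1 + 1) ε r δ (Fin.natAdd (s + 1) 0) (Fin.castAdd 1 i) ∩
                {u | configEnergy u ≤ V ^ 2 / 2}).indicator (fun _ => (1 : ℝ≥0∞))
              (freeFlight (Torus.geometry d) (-τ)
                (collidePair (Torus.geometry d) (Fin.natAdd (s + 1) 0) (Fin.castAdd 1 i)
                  (contactInsert ε (Fin.natAdd (s + 1) 0) (Fin.castAdd 1 i) (ω : EuclideanSpace ℝ d) z))) *
            H (contactInsert ε (Fin.natAdd (s + 1) 0) (Fin.castAdd 1 i) (ω : EuclideanSpace ℝ d) z)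
        ∂volume ∂(volume : Measure (EuclideanSpace ℝ d)).toSphere := by
  classical
  have hr0 : 0 ≤ r := le_trans (by positivity) hr
  have hε' : ε < 2⁻¹ := by linarith
  have hρ : ε + r < 1 / 2 := by rw [one_div]; linarith
  -- the two integrands
  set g : Config (s + 1 + 1) d (UnitAddTorus d) → ℝ≥0∞ := fun u =>
    (Alexander.hitPiece (s + 1 + 1) ε r δ (Fin.natAdd (s + 1) 0) (Fin.castAdd 1 i) ∩
        {u | configEnergy u ≤ V ^ 2 / 2}).indicator
      (fun u => H (collidePair (Torus.geometry d) (Fin.natAdd (s + 1) 0) (Fin.castAdd 1 i)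
        (freeFlight (Torus.geometry d)
          (pairHitTime ε ((Torus.geometry d).sepVec (u (Fin.natAdd (s + 1) 0)).1 (u (Fin.castAdd 1 i)).1)
            ((u (Fin.natAdd (s + 1) 0)).2 - (u (Fin.castAdd 1 i)).2)) u))) u with hg
  set F : Config (s + 1 + 1) d (UnitAddTorus d) → ℝ≥0∞ := fun z =>
    ∫⁻ ω : Metric.sphere (0 : EuclideanSpace ℝ d) 1, ∫⁻ τ in Ioc (0 : ℝ) δ,
      ENNReal.ofReal (ε ^ (Fintype.card d - 1) *
          ⟪((ω : EuclideanSpace ℝ d)), (z (Fin.natAdd (s + 1) 0)).2 - (z (Fin.castAdd 1 i)).2⟫) *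
        (Alexander.hitPiece (s + 1 + 1) ε r δ (Fin.natAdd (s + 1) 0) (Fin.castAdd 1 i) ∩
            {u | configEnergy u ≤ V ^ 2 / 2}).indicator (fun _ => (1 : ℝ≥0∞))
          (freeFlight (Torus.geometry d) (-τ)
            (collidePair (Torus.geometry d) (Fin.natAdd (s + 1) 0) (Fin.castAdd 1 i)
              (contactInsert ε (Fin.natAdd (s + 1) 0) (Fin.castAdd 1 i) (ω : EuclideanSpace ℝ d) z))) *
        H (contactInsert ε (Fin.natAdd (s + 1) 0) (Fin.castAdd 1 i) (ω : EuclideanSpace ℝ d) z)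
    ∂volume ∂(volume : Measure (EuclideanSpace ℝ d)).toSphere with hF
  show ∫⁻ u, g u = ∫⁻ z, F z
  have hgm : Measurable g := campbell_measurable_hitPieceIntegrand ε r δ V _ _ hH
  have hFm : Measurable F := campbell_measurable_cylinderIntegral ε r δ V _ _ hH
  -- hit-piece data are supported in the chart of radius `ε + r`
  have hg0 : ∀ (W' : Config (s + 1) d (UnitAddTorus d)) (w : EuclideanSpace ℝ d) (r' : EuclideanSpace ℝ d),
      r' ∈ Torus.symCube d → r' ∉ closedBall (0 : EuclideanSpace ℝ d) (ε + r) ∩ collisionCylRegion ε (w - (W' i).2) →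
        g (flipVel (appendParticle W' ((W' i).1 + FunctionSpaces.Torus.proj r') w)) = 0 := by
    intro W' w r' hr' hnot
    simp only [hg]
    exact indicator_of_notMem (fun hmem => hnot (campbell_chart_of_mem_hitPiece hε i W' w r' hr' hmem.1)) _
  have key := lintegral_eq_boundaryFlux_backward i hε hρ g hgm hg0
  -- the dictionary: in the coordinates `z = (Z', x, v)` the integrand does not depend on `x`
  have hdict : ∀ (Z' : Config (s + 1) d (UnitAddTorus d)) (x : UnitAddTorus d) (v : EuclideanSpace ℝ d),
      F (appendParticle Z' x v) = ∫⁻ ν : Metric.sphere (0 : EuclideanSpace ℝ d) 1, ∫⁻ τ in Ioc (0 : ℝ) δ,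
        ENNReal.ofReal (ε ^ (Fintype.card d - 1) * ⟪((ν : EuclideanSpace ℝ d)), v - (Z' i).2⟫) *
          (Alexander.hitPiece (s + 1 + 1) ε r δ (Fin.natAdd (s + 1) 0) (Fin.castAdd 1 i) ∩
              {u | configEnergy u ≤ V ^ 2 / 2}).indicator (fun _ => (1 : ℝ≥0∞))
            (freeFlight (Torus.geometry d) (-τ) (gainConfig (Torus.geometry d) ε Z' i ν v)) *
          H (lossConfig (Torus.geometry d) ε Z' i ν v)
        ∂volume ∂(volume : Measure (EuclideanSpace ℝ d)).toSphere := by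
    intro Z' x v
    simp only [hF, appendParticle_last, appendParticle_castAdd, campbell_contactInsert_appendParticle,
      campbell_collidePair_lossConfig hε hε']
  -- the `τ`-integrals over the window as integrals over `(0, ∞)`
  have hIoc : ∀ f : ℝ → ℝ≥0∞, ∫⁻ τ in Ioc (0 : ℝ) δ, f τ = ∫⁻ τ in Ioi (0 : ℝ), (Iic δ).indicator f τ := by
    intro f
    rw [lintegral_indicator measurableSet_Iic, Measure.restrict_restrict measurableSet_Iic, Iic_inter_Ioi]
  rw [← key, lintegral_config_succ F hFm]
  refine lintegral_congr fun Z' => ?_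
  have hm : Measurable fun p : UnitAddTorus d × EuclideanSpace ℝ d => F (appendParticle Z' p.1 p.2) :=
    hFm.comp (measurable_appendParticle measurable_const measurable_fst measurable_snd)
  rw [Measure.volume_eq_prod,
    lintegral_prod (fun p : UnitAddTorus d × EuclideanSpace ℝ d => F (appendParticle Z' p.1 p.2)) hm.aemeasurable]
  simp only [hdict, lintegral_const, measure_univ, mul_one]
  refine lintegral_congr fun v => lintegral_congr fun ν => ?_
  rw [hIoc]
  refine setLIntegral_congr_fun measurableSet_Ioi (fun τ hτ => ?_)
  exact (campbell_cylinder_pointwise i hε hch hr hV hδ H Z' v ν hτ).symm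

end

end Literature.MathematicalPhysics.KineticTheory
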